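/-
Copyright (c) 2026 the pub-hodgecm-mathlib formalisation cell (harness21).  Prover seat hodgecm-mathlib-K2E3-p17 (g2),
Track B «K2-LIT» ∕ h413, line `K2_E3_EllipticInputs`, unit U5 — ROAD K-EP toward #20′ `sig_K2E3PseudoCoeffPosOnePi2`, THIRD BRICK sub-brick (3b):
THE COSET MODEL `V^{K⁺} ↪ Fun(K∕J)` OF THE LEVEL-FIXED VECTORS OF AN INDUCED REPRESENTATION.  2026-09-04.
-/
import Literature.NumberTheory.Automorphic.SmoothInduction
import Summits.HodgeConjecture.HodgeConjecture.Theorems.K2E3PermutationModuleBorelFixedConstant   -- ★ p855843 (3a): averaging lemma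
import Summits.HodgeConjecture.HodgeConjecture.Theorems.K2E3PermutationModuleMeanZeroOfFixed       -- ★ p855886 (3a″): mean-zero hyperplane
import Mathlib
import HarnessLib

/-!
# K2_E3 road K-EP (#20′), third brick (3b): the coset model `(Ind_H^G σ)^{K⁺} ↪ Fun(K ∕ J)` (`K`-equivariant, injective)

Cell `pub/hodgecm-mathlib` (D-0151), Track B; dealer K2E3-plan (g1) 23:40:43Z (e) «#20′ ↦ K2E3-p17»; K2E3-p17 (g2) REPORT-FIRST 23:50:39Z ∕ refinement
(uniform SUB-constituent argument).  THEOREMS ONLY (the model map is delivered as an EXISTENCE statement, no `def`); GENERIC: a topological group `G`,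
subgroups `H` (inducing), `K` (a parahoric), `K⁺ ≤ J` (its level group and its «Iwahori» `J = (H ∩ K)·K⁺`), a character `σ` of `H` on the line `k`
(★ `Representation.SmoothInd H σ`, right translation), over any field `k`.

WHAT.  Hypotheses: `K⁺` normal in `K` (`hnorm`), every `j ∈ J` factors `j = h·u` with `h ∈ H`, `σ h = 1`, `u ∈ K⁺` (`hJ` — depth zero: the inducing character
is trivial on `H ∩ K`), and (for injectivity ∕ the fixed-vector dictionary) the Iwasawa cover `G = H·K` (`hcover`).  For `f ∈ V^{K⁺}`, `V = Ind_H^G σ`, the function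
`Φ f : K∕J → k`, `Φ f (κJ) = f(κ⁻¹)` is well defined (§1 `toFun_inv_mul_eq_of_mem`), and:
* §2 **`exists_cosetModel`** — a `k`-linear `Φ : V^{K⁺} → (K∕J → k)` with `Φ f (κJ) = f(κ⁻¹)` EXISTS;
* §3 for ANY such `Φ`: `cosetModel_injective` (needs `hcover`); `cosetModel_smul` — EQUIVARIANCE `Φ (κ • f) = (x ↦ Φ f (κ⁻¹ • x))` (so a `K`-stable subspace of
  `V^{K⁺}` maps to a translation-stable subspace of `Fun(K∕J)`, the `hW` of ★ (3a)∕(3a″)); `cosetModel_invariant_iff_mem_fixedPoints` — `Φ f` is invariant under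
  a subgroup `L`, `K⁺ ≤ L ≤ K` (through `hL`: same factorisation hypothesis as `J`… no: ANY `L ≤ K`) iff `f ∈ V^{L}`; in particular `Φ f` is CONSTANT iff `f` is
  `K`-fixed (`cosetModel_const_iff`), and `J`-invariant iff `f ∈ V^{J}`.
* §4 **`finrank_inf_fixedPoints_dichotomy`** — THE PAYOFF: with `K∕J` finite of RANK ONE (`J` transitive off the base point) and `S ≤ V` a `K`-stable subspace with a
  `J`-fixed LINE, `dim (S ∩ V^{K⁺}) = 1` if `S` is `K`-spherical and `= |K∕J| − 1` otherwise (★ p855843 averaging lemma ∕ ★ p855886 mean-zero hyperplane on the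
  coset model).  For the irreducible sub-constituent `S` of a depth-zero principal series of `U(3)` at `(K, J, K⁺) = (K₀, I, K₀⁺)`: `dim S^{K₀⁺} ∈ {1, q³}`; the quotient
  constituent gets the complementary value by ★ JH-PAIR-RANKS (sub-brick (3b′), next).

HONEST LABEL: HC_CM is proved only modulo the 7 printed citations (2 remaining named inputs: hLiu418 = stmt-HodgeConjecture-24832, h413 =
stmt-HodgeConjecture-24833) until rung 0 closes; `--supports stmt-HodgeConjecture-24833` helper, COUNT-NEUTRAL (the socket #20′ it serves is not yet minted).

## References
* [BernsteinZelevinsky1976] I. N. Bernstein, A. V. Zelevinsky, *Representations of the group GL(n,F)…*, Russian Math. Surveys 31:3 (1976), §2.21–2.25.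
* [Borel1976] A. Borel, *Admissible representations … fixed under an Iwahori subgroup*, Invent. Math. 35 (1976), §3–§4.
* [Casselman1995] W. Casselman, *Introduction to the theory of admissible representations of 𝔭-adic reductive groups* (1995), §3 (`V^{K⁺}` as a `K∕K⁺`-module).
-/

set_option autoImplicit false
-- the mandated namespace has the single-problem summit's repeated segment (`HodgeConjecture.HodgeConjecture`)
set_option linter.dupNamespace false

open scoped BigOperators

namespace Summit.HodgeConjecture.HodgeConjecture.Cruxes.H413.K2E3SmoothIndLevelFixedCosetModel

open Representation

variable {k : Type*} [Field k] {G : Type*} [Group G] [TopologicalSpace G] [SeparatelyContinuousMul G]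
variable (H K Kp J : Subgroup G) (σ : Representation k ↥H k)

/-! ## §1  The values `f(κ⁻¹)`, `κ ∈ K`, of a `K⁺`-fixed vector are `J`-periodic -/

/-- For `f ∈ V^{K⁺}` (`V = Ind_H^G σ`) and `u ∈ K⁺`, `κ ∈ K` with `K⁺ ⊴ K`: **`f(u·κ⁻¹) = f(κ⁻¹)`** (`u κ⁻¹ = κ⁻¹·(κ u κ⁻¹)` and `f` is right-`K⁺`-invariant).
[cite: BernsteinZelevinsky1976, §2.21] -/
theorem toFun_levelMul_inv_eq (hnorm : ∀ κ ∈ K, ∀ u ∈ Kp, κ * u * κ⁻¹ ∈ Kp)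
    {f : SmoothInd H σ} (hf : f ∈ (smoothIndRep H σ).fixedPoints Kp) {κ u : G} (hκ : κ ∈ K) (hu : u ∈ Kp) :
    f.toFun (u * κ⁻¹) = f.toFun κ⁻¹ := by
  have hu' : κ * u * κ⁻¹ ∈ Kp := hnorm κ hκ u hu
  have hfix := (mem_fixedPoints _ _ _).1 hf (κ * u * κ⁻¹) hu'
  have := congrArg (fun g : SmoothInd H σ => g.toFun κ⁻¹) hfix
  simp only [toFun_smoothIndRep_apply] at this
  rw [show κ⁻¹ * (κ * u * κ⁻¹) = u * κ⁻¹ by group] at this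
  exact this

/-- For `f ∈ V^{K⁺}`, `κ ∈ K`, `j ∈ J` with `j = h·u`, `h ∈ H`, `σ h = 1`, `u ∈ K⁺` (depth zero): **`f((κ j)⁻¹) = f(κ⁻¹)`** — the function `κ ↦ f(κ⁻¹)` on `K`
descends to `K ∕ J`. [cite: BernsteinZelevinsky1976, §2.21] [cite: Casselman1995, §3] -/
theorem toFun_inv_mul_eq_of_mem (hnorm : ∀ κ ∈ K, ∀ u ∈ Kp, κ * u * κ⁻¹ ∈ Kp)
    (hJ : ∀ j ∈ J, ∃ (h : G) (hh : h ∈ H) (u : G), u ∈ Kp ∧ j = h * u ∧ σ ⟨h, hh⟩ = 1)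
    {f : SmoothInd H σ} (hf : f ∈ (smoothIndRep H σ).fixedPoints Kp) {κ j : G} (hκ : κ ∈ K) (hj : j ∈ J) :
    f.toFun (κ * j)⁻¹ = f.toFun κ⁻¹ := by
  obtain ⟨h, hh, u, hu, hju, hσ⟩ := hJ j⁻¹ (J.inv_mem hj)
  rw [mul_inv_rev, hju, mul_assoc, f.toFun_subgroup_mul ⟨h, hh⟩ (u * κ⁻¹), hσ, Module.End.one_apply,
    toFun_levelMul_inv_eq H K Kp σ hnorm hf hκ hu]

/-! ## §2  The coset model exists -/

/-- **THE COSET MODEL EXISTS.**  Under `K⁺ ⊴ K` and the depth-zero factorisation of `J`, there is a `k`-LINEAR map `Φ : V^{K⁺} → (K∕J → k)` with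
`Φ f (κJ) = f(κ⁻¹)` (`J` viewed in `K` as `J.subgroupOf K`; `K` acts on `K∕J` by left translation). [cite: BernsteinZelevinsky1976, §2.21] [cite: Casselman1995, §3] -/
theorem exists_cosetModel (hnorm : ∀ κ ∈ K, ∀ u ∈ Kp, κ * u * κ⁻¹ ∈ Kp)
    (hJ : ∀ j ∈ J, ∃ (h : G) (hh : h ∈ H) (u : G), u ∈ Kp ∧ j = h * u ∧ σ ⟨h, hh⟩ = 1) :
    ∃ Φ : ↥((smoothIndRep H σ).fixedPoints Kp) →ₗ[k] ((↥K ⧸ J.subgroupOf K) → k),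
      ∀ (f : ↥((smoothIndRep H σ).fixedPoints Kp)) (κ : ↥K),
        Φ f (QuotientGroup.mk κ) = (f : SmoothInd H σ).toFun ((κ : G)⁻¹) := by
  -- well-definedness on cosets
  have hwd : ∀ (f : ↥((smoothIndRep H σ).fixedPoints Kp)) (a b : ↥K),
      QuotientGroup.leftRel (J.subgroupOf K) a b → (f : SmoothInd H σ).toFun ((a : G)⁻¹) = (f : SmoothInd H σ).toFun ((b : G)⁻¹) := by
    intro f a b hab
    rw [QuotientGroup.leftRel_apply, Subgroup.mem_subgroupOf] at hab
    have hb : (b : G) = a * ((a : G)⁻¹ * b) := by group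
    rw [hb]
    exact (toFun_inv_mul_eq_of_mem H K Kp J σ hnorm hJ f.2 a.2 (by simpa using hab)).symm
  refine ⟨{ toFun := fun f x => Quotient.liftOn' x (fun κ : ↥K => (f : SmoothInd H σ).toFun ((κ : G)⁻¹)) (hwd f)
            map_add' := fun f g => ?_
            map_smul' := fun c f => ?_ }, fun f κ => rfl⟩
  · funext x
    induction x using QuotientGroup.induction_on with
    | H κ => rfl
  · funext x
    induction x using QuotientGroup.induction_on with
    | H κ => rfl

/-! ## §3  Properties of any coset model `Φ` -/

/-- `κ • f ∈ V^{K⁺}` for `f ∈ V^{K⁺}`, `κ ∈ K` (normality of `K⁺` in `K`). [cite: Casselman1995, §3] -/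
theorem smul_mem_fixedPoints (hnorm : ∀ κ ∈ K, ∀ u ∈ Kp, κ * u * κ⁻¹ ∈ Kp)
    {κ : G} (hκ : κ ∈ K) {f : SmoothInd H σ} (hf : f ∈ (smoothIndRep H σ).fixedPoints Kp) :
    smoothIndRep H σ κ f ∈ (smoothIndRep H σ).fixedPoints Kp := by
  rw [mem_fixedPoints] at hf ⊢
  intro u hu
  have hu' : κ⁻¹ * u * κ⁻¹⁻¹ ∈ Kp := hnorm κ⁻¹ (K.inv_mem hκ) u hu
  rw [inv_inv] at hu'
  calc smoothIndRep H σ u (smoothIndRep H σ κ f)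
      = smoothIndRep H σ κ (smoothIndRep H σ (κ⁻¹ * u * κ) f) := by
          rw [← Module.End.mul_apply, ← map_mul, ← Module.End.mul_apply, ← map_mul]
          congr 1; group
    _ = smoothIndRep H σ κ f := by rw [hf _ hu']

section Properties

variable {H K Kp J σ}
variable (Φ : ↥((smoothIndRep H σ).fixedPoints Kp) →ₗ[k] ((↥K ⧸ J.subgroupOf K) → k))
  (hΦ : ∀ (f : ↥((smoothIndRep H σ).fixedPoints Kp)) (κ : ↥K), Φ f (QuotientGroup.mk κ) = (f : SmoothInd H σ).toFun ((κ : G)⁻¹))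
include hΦ

/-- **INJECTIVITY** (Iwasawa cover `G = H·K`): `Φ f = 0 ⇒ f = 0` — `f` vanishes on `K`, hence on `H·K = G`. [cite: BernsteinZelevinsky1976, §2.21–2.25] -/
theorem cosetModel_injective (hcover : ∀ x : G, ∃ h : G, h ∈ H ∧ ∃ κ : G, κ ∈ K ∧ x = h * κ) :
    Function.Injective Φ := by
  refine (injective_iff_map_eq_zero Φ).2 fun f hf0 => ?_
  have hK : ∀ κ : G, κ ∈ K → (f : SmoothInd H σ).toFun κ = 0 := by
    intro κ hκ
    have := hΦ f ⟨κ⁻¹, K.inv_mem hκ⟩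
    rw [hf0] at this
    simpa using this.symm
  apply Subtype.ext
  apply SmoothInd.ext
  funext x
  obtain ⟨h, hh, κ, hκ, rfl⟩ := hcover x
  rw [(f : SmoothInd H σ).toFun_subgroup_mul ⟨h, hh⟩ κ, hK κ hκ, map_zero]
  rfl

/-- **EQUIVARIANCE**: for `κ ∈ K` and `f ∈ V^{K⁺}`, `κ • f ∈ V^{K⁺}` (normality) and `Φ (κ • f) = (x ↦ Φ f (κ⁻¹ • x))`. [cite: Casselman1995, §3] -/
theorem cosetModel_smul
    (κ : ↥K) (f g : ↥((smoothIndRep H σ).fixedPoints Kp)) (hfg : (g : SmoothInd H σ) = smoothIndRep H σ (κ : G) (f : SmoothInd H σ)) :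
    Φ g = fun x => Φ f (κ⁻¹ • x) := by
  funext x
  induction x using QuotientGroup.induction_on with
  | H a =>
    rw [MulAction.Quotient.smul_mk, hΦ, hΦ, hfg, toFun_smoothIndRep_apply]
    congr 1
    simp [mul_inv_rev]

/-- **INVARIANCE DICTIONARY**: for a subgroup `L ≤ K` and `f ∈ V^{K⁺}`, the function `Φ f` is invariant under `L` (acting on `K∕J` by left translation)
iff `f ∈ V^{L}` (needs the cover `G = H·K` for «⇒»).  At `L = J`: «`J`-invariant ↔ Iwahori-fixed»; at `L = K`: «constant ↔ spherical».
[cite: Borel1976, §3–§4] [cite: Casselman1995, §3] -/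
theorem cosetModel_invariant_iff_mem_fixedPoints (hcover : ∀ x : G, ∃ h : G, h ∈ H ∧ ∃ κ : G, κ ∈ K ∧ x = h * κ)
    {L : Subgroup G} (hLK : L ≤ K) (f : ↥((smoothIndRep H σ).fixedPoints Kp)) :
    (∀ l : ↥K, (l : G) ∈ L → ∀ x, Φ f (l • x) = Φ f x) ↔ (f : SmoothInd H σ) ∈ (smoothIndRep H σ).fixedPoints L := by
  constructor
  · intro hinv
    rw [mem_fixedPoints]
    intro l hl
    apply SmoothInd.ext
    funext x
    rw [toFun_smoothIndRep_apply]
    obtain ⟨h, hh, κ, hκ, rfl⟩ := hcover x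
    rw [mul_assoc, (f : SmoothInd H σ).toFun_subgroup_mul ⟨h, hh⟩ (κ * l), (f : SmoothInd H σ).toFun_subgroup_mul ⟨h, hh⟩ κ]
    congr 1
    -- `f (κ l) = f κ`: evaluate the invariance at `l⁻¹` and the coset of `(κ l)⁻¹`... via `x = (l⁻¹ κ⁻¹)⁻¹`
    have key := hinv ⟨l⁻¹, K.inv_mem (hLK hl)⟩ (L.inv_mem hl) (QuotientGroup.mk ⟨κ⁻¹, K.inv_mem hκ⟩)
    rw [MulAction.Quotient.smul_mk, hΦ, hΦ] at key
    simpa [mul_inv_rev] using key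
  · intro hf l hl x
    induction x using QuotientGroup.induction_on with
    | H a =>
      rw [MulAction.Quotient.smul_mk, hΦ, hΦ]
      have := (mem_fixedPoints _ _ _).1 hf (l : G)⁻¹ (L.inv_mem hl)
      have := congrArg (fun g : SmoothInd H σ => g.toFun ((a : G)⁻¹)) this
      simp only [toFun_smoothIndRep_apply] at this
      simpa [mul_inv_rev] using this

/-- **CONSTANT ↔ SPHERICAL**: `Φ f` is constant iff `f` is `K`-fixed. [cite: Borel1976, §3–§4] -/
theorem cosetModel_const_iff (hcover : ∀ x : G, ∃ h : G, h ∈ H ∧ ∃ κ : G, κ ∈ K ∧ x = h * κ)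
    (f : ↥((smoothIndRep H σ).fixedPoints Kp)) :
    (∀ x, Φ f x = Φ f (QuotientGroup.mk 1)) ↔ (f : SmoothInd H σ) ∈ (smoothIndRep H σ).fixedPoints K := by
  rw [← cosetModel_invariant_iff_mem_fixedPoints Φ hΦ hcover le_rfl f]
  constructor
  · intro hc l _ x
    rw [hc (l • x), hc x]
  · intro hinv x
    induction x using QuotientGroup.induction_on with
    | H a =>
      have := hinv a a.2 (QuotientGroup.mk 1)
      rw [MulAction.Quotient.smul_mk, smul_eq_mul, mul_one] at this
      exact this

end Properties

/-! ## §4  THE DICHOTOMY: a `K`-stable subspace of `V` with a `J`-fixed LINE has `dim ·^{K⁺} = 1` (spherical) or `[K:J] − 1` (non-spherical) -/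

/-- **THE DEPTH-ZERO DICHOTOMY.**  `V = Ind_H^G σ` with `K⁺ ⊴ K`, `K⁺ ≤ J ≤ K`, `J ⊆ (H ∩ K)_{σ = 1}·K⁺` (depth zero), `G = H·K` (Iwasawa), `K∕J` finite and
RANK ONE (`J` transitive on `(K∕J) ∖ {J}`, i.e. `K = J ⊔ J w̃ J`), `k` of characteristic zero.  Let `S ≤ V` be `K`-stable with a `J`-fixed LINE
(`dim (S ∩ V^{J}) = 1` — e.g. an irreducible sub-constituent of a principal series of `U(3)` with an Iwahori-fixed line).  Then
* if `S` has a `K`-fixed vector (`S ∩ V^{K} ≠ 0`, spherical): `dim (S ∩ V^{K⁺}) = 1` (★ averaging lemma p855843 on the coset model);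
* if not (`S ∩ V^{K} = 0`): `dim (S ∩ V^{K⁺}) = |K∕J| − 1` (★ mean-zero hyperplane p855886).
Consumer: `S` = the irreducible sub of the depth-zero `i_G(χ₁) ⊇ {π²(ξ₀), πⁿ(ξ₀)}` at `K = K₀`, `J = I`, `K⁺ = K₀⁺`: `dim S^{K₀⁺} ∈ {1, q³}`; the quotient constituent
gets the complementary value by ★ JH-PAIR-RANKS. [cite: Borel1976, §3–§4] [cite: Casselman1995, §3] [cite: BernsteinZelevinsky1976, §2.21–2.25] -/
theorem finrank_inf_fixedPoints_dichotomy [CharZero k] [Fintype (↥K ⧸ J.subgroupOf K)]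
    (hnorm : ∀ κ ∈ K, ∀ u ∈ Kp, κ * u * κ⁻¹ ∈ Kp)
    (hJ : ∀ j ∈ J, ∃ (h : G) (hh : h ∈ H) (u : G), u ∈ Kp ∧ j = h * u ∧ σ ⟨h, hh⟩ = 1)
    (hcover : ∀ x : G, ∃ h : G, h ∈ H ∧ ∃ κ : G, κ ∈ K ∧ x = h * κ)
    (hKpJ : Kp ≤ J) (hJK : J ≤ K)
    (hrank : ∀ x y : ↥K ⧸ J.subgroupOf K, x ≠ QuotientGroup.mk 1 → y ≠ QuotientGroup.mk 1 → ∃ j : ↥K, (j : G) ∈ J ∧ j • x = y)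
    (S : Submodule k (SmoothInd H σ)) (hS : ∀ κ : G, κ ∈ K → ∀ f ∈ S, smoothIndRep H σ κ f ∈ S)
    (hSJ : Module.finrank k ↥(S ⊓ (smoothIndRep H σ).fixedPoints J) = 1) :
    (S ⊓ (smoothIndRep H σ).fixedPoints K ≠ ⊥ → Module.finrank k ↥(S ⊓ (smoothIndRep H σ).fixedPoints Kp) = 1) ∧
    (S ⊓ (smoothIndRep H σ).fixedPoints K = ⊥ →
      Module.finrank k ↥(S ⊓ (smoothIndRep H σ).fixedPoints Kp) = Fintype.card (↥K ⧸ J.subgroupOf K) - 1) := by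
  classical
  obtain ⟨Φ, hΦ⟩ := exists_cosetModel H K Kp J σ hnorm hJ
  have hinj := cosetModel_injective Φ hΦ hcover
  -- abbreviations
  have hJKp : (smoothIndRep H σ).fixedPoints J ≤ (smoothIndRep H σ).fixedPoints Kp := (smoothIndRep H σ).fixedPoints_antitone hKpJ
  have hKKp : (smoothIndRep H σ).fixedPoints K ≤ (smoothIndRep H σ).fixedPoints Kp := (smoothIndRep H σ).fixedPoints_antitone (hKpJ.trans hJK)
  have hKJ' : (smoothIndRep H σ).fixedPoints K ≤ (smoothIndRep H σ).fixedPoints J := (smoothIndRep H σ).fixedPoints_antitone hJK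
  -- the image `W` of `N' = S ∩ V^{K⁺}` (pulled back to `↥V^{K⁺}`)
  let N' : Submodule k ↥((smoothIndRep H σ).fixedPoints Kp) := (S ⊓ (smoothIndRep H σ).fixedPoints Kp).comap ((smoothIndRep H σ).fixedPoints Kp).subtype
  let W : Submodule k ((↥K ⧸ J.subgroupOf K) → k) := N'.map Φ
  have hmemN' : ∀ f : ↥((smoothIndRep H σ).fixedPoints Kp), f ∈ N' ↔ (f : SmoothInd H σ) ∈ S := by
    intro f
    simp only [N', Submodule.mem_comap, Submodule.subtype_apply, Submodule.mem_inf, f.2, and_true]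
  have hWN : Module.finrank k W = Module.finrank k ↥(S ⊓ (smoothIndRep H σ).fixedPoints Kp) := by
    rw [← LinearEquiv.finrank_eq (Submodule.equivMapOfInjective Φ hinj N')]
    exact LinearEquiv.finrank_eq (Submodule.comapSubtypeEquivOfLe inf_le_right)
  -- base point, transitivity, stabiliser
  set x₀ : ↥K ⧸ J.subgroupOf K := QuotientGroup.mk 1 with hx₀
  let B : Subgroup ↥K := J.subgroupOf K
  have htrans : ∀ x : ↥K ⧸ J.subgroupOf K, ∃ g : ↥K, g • x₀ = x := by
    intro x
    induction x using QuotientGroup.induction_on with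
    | H a => exact ⟨a, by rw [hx₀, MulAction.Quotient.smul_mk, smul_eq_mul, mul_one]⟩
  have hBx₀ : ∀ b ∈ B, b • x₀ = x₀ := by
    intro b hb
    rw [hx₀, MulAction.Quotient.smul_mk, smul_eq_mul, mul_one, QuotientGroup.eq, mul_one]
    exact B.inv_mem hb
  have hBtrans : ∀ x y : ↥K ⧸ J.subgroupOf K, x ≠ x₀ → y ≠ x₀ → ∃ b ∈ B, b • x = y := by
    intro x y hx hy
    obtain ⟨j, hj, hjxy⟩ := hrank x y hx hy
    exact ⟨j, Subgroup.mem_subgroupOf.2 hj, hjxy⟩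
  -- translation stability of `W`
  have hW : ∀ (g : ↥K), ∀ F ∈ W, (fun x => F (g • x)) ∈ W := by
    intro g F hF
    obtain ⟨f, hfN, rfl⟩ := Submodule.mem_map.1 hF
    have hfS : (f : SmoothInd H σ) ∈ S := (hmemN' f).1 hfN
    let f' : ↥((smoothIndRep H σ).fixedPoints Kp) := ⟨smoothIndRep H σ ((g : G)⁻¹) (f : SmoothInd H σ), smul_mem_fixedPoints H K Kp σ hnorm (K.inv_mem g.2) f.2⟩
    have hf'N : f' ∈ N' := (hmemN' f').2 (hS _ (K.inv_mem g.2) _ hfS)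
    have hΦf' : Φ f' = fun x => Φ f (g • x) := by
      have := cosetModel_smul Φ hΦ g⁻¹ f f' rfl
      simpa using this
    rw [← hΦf']
    exact Submodule.mem_map_of_mem hf'N
  -- the `J`-invariance dictionary for elements of `N'`
  have hdictJ : ∀ f : ↥((smoothIndRep H σ).fixedPoints Kp), (∀ b ∈ B, ∀ x, Φ f (b • x) = Φ f x) ↔ (f : SmoothInd H σ) ∈ (smoothIndRep H σ).fixedPoints J := by
    intro f
    rw [← cosetModel_invariant_iff_mem_fixedPoints Φ hΦ hcover hJK f]
    constructor
    · intro h l hl x; exact h l (Subgroup.mem_subgroupOf.2 hl) x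
    · intro h b hb x; exact h b (Subgroup.mem_subgroupOf.1 hb) x
  refine ⟨fun hsph => ?_, fun hnsph => ?_⟩
  · -- SPHERICAL CASE
    obtain ⟨f₀, hf₀mem, hf₀ne⟩ := (Submodule.ne_bot_iff _).1 hsph
    obtain ⟨hf₀S, hf₀K⟩ := Submodule.mem_inf.1 hf₀mem
    let g₀ : ↥((smoothIndRep H σ).fixedPoints Kp) := ⟨f₀, hKKp hf₀K⟩
    have hg₀N : g₀ ∈ N' := (hmemN' g₀).2 hf₀S
    have hg₀const : ∀ x, Φ g₀ x = Φ g₀ x₀ := (cosetModel_const_iff Φ hΦ hcover g₀).2 hf₀K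
    -- every `J`-fixed element of `W` is constant
    have hB : ∀ F ∈ W, (∀ b ∈ B, ∀ x, F (b • x) = F x) → ∀ x, F x = F x₀ := by
      intro F hF hFB
      obtain ⟨f, hfN, rfl⟩ := Submodule.mem_map.1 hF
      have hfS : (f : SmoothInd H σ) ∈ S := (hmemN' f).1 hfN
      have hfJ : (f : SmoothInd H σ) ∈ (smoothIndRep H σ).fixedPoints J := (hdictJ f).1 hFB
      -- `S ∩ V^J` is the line through `f₀`
      have hline := (finrank_eq_one_iff_of_nonzero' (⟨f₀, Submodule.mem_inf.2 ⟨hf₀S, hKJ' hf₀K⟩⟩ : ↥(S ⊓ (smoothIndRep H σ).fixedPoints J))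
        (by intro h; exact hf₀ne (congrArg Subtype.val h))).1 hSJ ⟨f, Submodule.mem_inf.2 ⟨hfS, hfJ⟩⟩
      obtain ⟨c, hc⟩ := hline
      have hfc : f = c • g₀ := by
        apply Subtype.ext
        have := congrArg Subtype.val hc
        simpa using this.symm
      intro x
      rw [hfc, map_smul, Pi.smul_apply, Pi.smul_apply, hg₀const x]
    have h1 : (fun _ : ↥K ⧸ J.subgroupOf K => (1 : k)) ∈ W := by
      -- `Φ g₀` is a non-zero constant `c₀`; `𝟙 = c₀⁻¹ • Φ g₀`
      have hΦg₀ne : Φ g₀ ≠ 0 := by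
        intro h0
        apply hf₀ne
        have : g₀ = 0 := hinj (by rw [h0, map_zero])
        exact congrArg Subtype.val this
      have hc₀ : Φ g₀ x₀ ≠ 0 := by
        intro h0
        apply hΦg₀ne
        funext x
        rw [hg₀const x, h0]; rfl
      have : (fun _ : ↥K ⧸ J.subgroupOf K => (1 : k)) = (Φ g₀ x₀)⁻¹ • Φ g₀ := by
        funext x
        rw [Pi.smul_apply, smul_eq_mul, hg₀const x, inv_mul_cancel₀ hc₀]
      rw [this]
      exact W.smul_mem _ (Submodule.mem_map_of_mem hg₀N)
    rw [← hWN]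
    exact K2E3PermutationModuleBorelFixedConstant.finrank_eq_one_of_fixed_imp_const B x₀ hBx₀ htrans W hW hB h1
  · -- NON-SPHERICAL CASE
    have h1 : (fun _ : ↥K ⧸ J.subgroupOf K => (1 : k)) ∉ W := by
      intro h1
      obtain ⟨f, hfN, hf1⟩ := Submodule.mem_map.1 h1
      have hfS : (f : SmoothInd H σ) ∈ S := (hmemN' f).1 hfN
      have hconst : ∀ x, Φ f x = Φ f x₀ := by intro x; rw [hf1]
      have hfK : (f : SmoothInd H σ) ∈ (smoothIndRep H σ).fixedPoints K := (cosetModel_const_iff Φ hΦ hcover f).1 hconst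
      have hf0 : (f : SmoothInd H σ) = 0 := by
        have : (f : SmoothInd H σ) ∈ S ⊓ (smoothIndRep H σ).fixedPoints K := Submodule.mem_inf.2 ⟨hfS, hfK⟩
        rw [hnsph] at this
        exact (Submodule.mem_bot k).1 this
      have hf0' : f = 0 := Subtype.ext hf0
      have := congr_fun hf1 x₀
      rw [hf0', map_zero, Pi.zero_apply] at this
      exact one_ne_zero this.symm
    -- a non-zero `J`-fixed vector of `W`
    obtain ⟨f₁, hf₁ne⟩ : ∃ f₁ : ↥(S ⊓ (smoothIndRep H σ).fixedPoints J), f₁ ≠ 0 := by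
      by_contra hno
      have hno' : ∀ f₁ : ↥(S ⊓ (smoothIndRep H σ).fixedPoints J), f₁ = 0 := fun f₁ => Classical.not_not.1 fun h => hno ⟨f₁, h⟩
      haveI : Subsingleton ↥(S ⊓ (smoothIndRep H σ).fixedPoints J) := ⟨fun a b => (hno' a).trans (hno' b).symm⟩
      rw [Module.finrank_zero_of_subsingleton] at hSJ
      exact zero_ne_one hSJ
    obtain ⟨hf₁S, hf₁J⟩ := Submodule.mem_inf.1 f₁.2
    let g₁ : ↥((smoothIndRep H σ).fixedPoints Kp) := ⟨(f₁ : SmoothInd H σ), hJKp hf₁J⟩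
    have hg₁N : g₁ ∈ N' := (hmemN' g₁).2 hf₁S
    have hφ : Φ g₁ ∈ W := Submodule.mem_map_of_mem hg₁N
    have hφB : ∀ b ∈ B, ∀ x, Φ g₁ (b • x) = Φ g₁ x := (hdictJ g₁).2 hf₁J
    have hφ0 : Φ g₁ ≠ 0 := by
      intro h0
      apply hf₁ne
      have : g₁ = 0 := hinj (by rw [h0, map_zero])
      have h' : (g₁ : SmoothInd H σ) = 0 := congrArg Subtype.val this
      apply Subtype.ext
      show ((f₁ : ↥(S ⊓ (smoothIndRep H σ).fixedPoints J)) : SmoothInd H σ) = 0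
      exact h'
    rw [← hWN]
    exact K2E3PermutationModuleMeanZeroOfFixed.finrank_eq_card_sub_one_of_fixed B x₀ hBtrans htrans W hW h1 hφ hφB hφ0

end Summit.HodgeConjecture.HodgeConjecture.Cruxes.H413.K2E3SmoothIndLevelFixedCosetModel
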